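import Summits.Ventures.CertifiedQuantumChemistry.Rows.SingletTempleSpinRows
import Literature.Computation.Certificates.TempleMomentCertificate
import HarnessLib

/-!
# Ventures/CertifiedQuantumChemistry — Rows/SingletTempleSpinIntervalRows.lean: the certnum plug of
# `Rows/SingletTempleSpinRows.lean` — a SINGLET Temple lower row from INTERVAL SHIFTED MOMENTS of a
# spin-contaminated sector trial (`TempleMoments.Cert` fields + ONE more enclosure `‖Ŝ_+ψ‖² ≤ shi`)

HONEST FRAMING (verbatim): certified bounds for a stated model Hamiltonian in a stated basis; not a
claim about the real molecule or material beyond that model.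

Typer chem-type-09 (LADDER-CHEM I-TYPE slot 09, custody of `Rows/Temple*`; door M1-OS STEP-2, chem-lead A28).
`Rows/SingletTempleSpinRows.lean` proves, for a symmetric model `F`, a gap leg on `K = (n, n)-sector ∩ ker Ŝ_+`
at `β`, an a-priori singlet lower row `L`, a sector vector `ψ` with `s ≥ ‖Ŝ_+ψ‖²` and the convex quadratic
`P(e) = M − (e + β)A + eβN + (s/8)(β − e)²` in the EXACT moments `N = ⟨ψ,ψ⟩`, `A = Re⟨ψ,Ĥψ⟩`, `M = Re⟨ψ,Ĥ²ψ⟩`: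
`P(L) < 0 ∧ P(lo) ≤ 0 ⇒ SingletLowerRow F n lo` (`singletLowerRow_of_temple_spin_codimOne`). Certnum's
interval kernel (RQ-011, `Literature/Computation/Certificates/TempleMomentCertificate.lean`) delivers instead
OUTWARD-ROUNDED enclosures of the SHIFTED moments at a dyadic shift `ρ`: `nlo ≤ ⟨ψ,ψ⟩ ≤ nhi`,
`alo ≤ Re⟨ψ,(Ĥ − ρ)ψ⟩ ≤ ahi`, `‖(Ĥ − ρ)ψ‖² ≤ bhi` («contract the SHIFTED operator directly — never `Ĥ²` then
subtract»). This file is the plumbing between the two, nothing else: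
* `templeSpinPoly_shift` — `P` is SHIFT-COVARIANT: with `a = A − ρN`, `m = M − 2ρA + ρ²N` it is the same
  polynomial in `e − ρ`, `β − ρ` (Weinstein–Stenger's `[φ(τ)]² = (Hw, Hw) − 2τ(Hw, w) + τ²(w, w)`; the `s`-term
  is manifestly shift-invariant);
* `templeSpinPoly_neg_of_check` / `templeSpinPoly_nonpos_of_check` — the interval evaluation at a rational point
  `e'` by sign-selected corners (certnum's branch-free rule `TempleMoments.min_mul_mul_le_mul`, Moore (1979)
  (2.19)): the rational number `bhi − min((e'+β')alo, (e'+β')ahi) − min((−e'β')nlo, (−e'β')nhi) + (shi/8)(β' − e')²`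
  bounds the true value from above, so its sign check transfers;
* `singletLowerRow_of_temple_spin_interval` — THE ONE-DECL CELL: gap leg + a-priori `L` + the four enclosures
  (`‖(Ĥ − ρ)ψ‖²` and `‖Ŝ_+ψ‖²` upper ends only) + the two decidable rational checks at `e' = L − ρ` (`< 0`) and
  `e' = lo − ρ` (`≤ 0`) ⇒ `SingletLowerRow F n lo`.
What is NOT here: a record type / `check` function (a `TempleMoments.Cert`-like record with one more field
`shi` is certnum's to add if wanted — the theorem takes the eight rationals as arguments), how the enclosures
are produced, the gap leg, any number. References: Weinstein–Stenger (1972) Ch. 5 §9 eq. (2), p. 104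
[cite: WeinsteinStenger1972, Ch. 5 §9 eq. (2), p. 104]; Moore (1979) §2.2 eq. (2.19) [cite: Moore1979, §2.2
eq. (2.19)]; Reed–Simon IV Thm XIII.5 [cite: ReedSimonIV1978, Thm XIII.5].
-/

noncomputable section

namespace Summit.Ventures.CertifiedQuantumChemistry

open Matrix Finset
open Literature.MathematicalPhysics.QuantumLattice Literature.MathematicalPhysics.QuantumChemistry
open Literature.MathematicalPhysics.QuantumLattice.EigenvalueContinuation
open Literature.Computation.Certificates
open scoped ComplexOrder

variable {k : ℕ}

/-! ## The certnum plug: interval SHIFTED moments + one spin enclosure -/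

/-- **SHIFT COVARIANCE of `P`.** With the shifted moments `a = A − ρN` (`= Re⟨ψ,(Ĥ − ρ)ψ⟩`) and
`m = M − 2ρA + ρ²N` (`= ‖(Ĥ − ρ)ψ‖²`), `P(e)` equals the same polynomial in the shifted variables
`e − ρ`, `β − ρ`: `m − (e' + β')a + e'β'N + (s/8)(β' − e')²`. (Weinstein–Stenger's shift bookkeeping
`[φ(τ)]² = (Hw, Hw) − 2τ(Hw, w) + τ²(w, w)`, extended by the manifestly shift-invariant `s`-term.)
[cite: WeinsteinStenger1972, Ch. 5 §9, p. 103] -/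
theorem templeSpinPoly_shift (ρ β e N A M s : ℝ) :
    M - (e + β) * A + e * β * N + s / 8 * (β - e) ^ 2 =
      (M - 2 * ρ * A + ρ ^ 2 * N) - ((e - ρ) + (β - ρ)) * (A - ρ * N) + (e - ρ) * (β - ρ) * N
        + s / 8 * ((β - ρ) - (e - ρ)) ^ 2 := by
  ring

/-- **The interval evaluation of the shifted polynomial at a rational point** (sign-selected corners,
branch-free — certnum's rule `TempleMoments.min_mul_mul_le_mul`): over the box `N ∈ [nlo, nhi]`,
`a ∈ [alo, ahi]`, `m ≤ bhi`, `s ≤ shi`, the value `m − (e' + β')a + e'β'N + (s/8)(β' − e')²` is at most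
`bhi − min((e'+β')·alo, (e'+β')·ahi) − min((−e'β')·nlo, (−e'β')·nhi) + (shi/8)(β' − e')²`; so a rational
STRICT check `< 0` on the latter gives `< 0` for the former. [cite: Moore1979, §2.2 eq. (2.19) with (2.14)] -/
theorem templeSpinPoly_neg_of_check {e' β' nlo nhi alo ahi bhi shi : ℚ} {N a m s : ℝ}
    (hnlo : (nlo : ℝ) ≤ N) (hnhi : N ≤ (nhi : ℝ)) (halo : (alo : ℝ) ≤ a) (hahi : a ≤ (ahi : ℝ))
    (hbhi : m ≤ (bhi : ℝ)) (hshi : s ≤ (shi : ℝ))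
    (hcheck : bhi - min ((e' + β') * alo) ((e' + β') * ahi) - min (-(e' * β') * nlo) (-(e' * β') * nhi)
      + shi / 8 * (β' - e') ^ 2 < 0) :
    m - ((e' : ℝ) + β') * a + (e' : ℝ) * β' * N + s / 8 * ((β' : ℝ) - e') ^ 2 < 0 := by
  have h1 := TempleMoments.min_mul_mul_le_mul ((e' : ℝ) + β') halo hahi
  have h2 := TempleMoments.min_mul_mul_le_mul (-((e' : ℝ) * β')) hnlo hnhi
  have h3 : s / 8 * ((β' : ℝ) - e') ^ 2 ≤ (shi : ℝ) / 8 * ((β' : ℝ) - e') ^ 2 :=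
    mul_le_mul_of_nonneg_right (by linarith) (sq_nonneg _)
  have hc := (Rat.cast_lt (K := ℝ)).2 hcheck
  push_cast at hc
  linarith

/-- The non-strict twin of `templeSpinPoly_neg_of_check` (the check at the claim point `lo`).
[cite: Moore1979, §2.2 eq. (2.19) with (2.14)] -/
theorem templeSpinPoly_nonpos_of_check {e' β' nlo nhi alo ahi bhi shi : ℚ} {N a m s : ℝ}
    (hnlo : (nlo : ℝ) ≤ N) (hnhi : N ≤ (nhi : ℝ)) (halo : (alo : ℝ) ≤ a) (hahi : a ≤ (ahi : ℝ))
    (hbhi : m ≤ (bhi : ℝ)) (hshi : s ≤ (shi : ℝ))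
    (hcheck : bhi - min ((e' + β') * alo) ((e' + β') * ahi) - min (-(e' * β') * nlo) (-(e' * β') * nhi)
      + shi / 8 * (β' - e') ^ 2 ≤ 0) :
    m - ((e' : ℝ) + β') * a + (e' : ℝ) * β' * N + s / 8 * ((β' : ℝ) - e') ^ 2 ≤ 0 := by
  have h1 := TempleMoments.min_mul_mul_le_mul ((e' : ℝ) + β') halo hahi
  have h2 := TempleMoments.min_mul_mul_le_mul (-((e' : ℝ) * β')) hnlo hnhi
  have h3 : s / 8 * ((β' : ℝ) - e') ^ 2 ≤ (shi : ℝ) / 8 * ((β' : ℝ) - e') ^ 2 :=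
    mul_le_mul_of_nonneg_right (by linarith) (sq_nonneg _)
  have hc := (Rat.cast_le (K := ℝ)).2 hcheck
  push_cast at hc
  linarith

/-- **SINGLET TEMPLE LOWER ROW FROM INTERVAL SHIFTED MOMENTS OF A SPIN-CONTAMINATED TRIAL** (the
certnum record's fields `ρ, nlo, nhi, alo, ahi, bhi` of `TempleMoments.Cert` + ONE more enclosure
`shi ≥ ‖Ŝ_+ψ‖²`). For a symmetric model `F`: the codimension-one gap leg on `K` at `β`; an a-priori singlet
lower row at `L`; a claim `lo`; a vector `ψ` of the `(n, n)` sector whose norm, SHIFTED first moment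
`Re⟨ψ,(Ĥ − ρ)ψ⟩`, shifted second moment `‖(Ĥ − ρ)ψ‖²` (upper end only) and spin contamination `‖Ŝ_+ψ‖²`
(upper end only) are enclosed by the given rationals; and the two DECIDABLE rational inequalities — with
`e' ∈ {L − ρ, lo − ρ}`, `β' = β − ρ`: `bhi − min((e'+β')alo, (e'+β')ahi) − min((−e'β')nlo, (−e'β')nhi)
+ (shi/8)(β' − e')²` is `< 0` at `e' = L − ρ` and `≤ 0` at `e' = lo − ρ`. Then `SingletLowerRow F n lo`,
i.e. `lo ≤ E₀(Ĥ_F; N = 2n, S = 0)` — `singletLowerRow_of_temple_spin_codimOne` after the shift covariance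
`templeSpinPoly_shift` (`‖(Ĥ − ρ)ψ‖² = M − 2ρA + ρ²N`, `re_residual_self_eq_moments`).
[cite: WeinsteinStenger1972, Ch. 5 §9 eq. (2), p. 104] -/
theorem singletLowerRow_of_temple_spin_interval {F : Model k} (hF : F.IsSymmetric) {n : ℕ}
    {β L lo : ℚ} (hG : SingletGapCertificateCodimOne F n β) (hL : SingletLowerRow F n L)
    {ψ : Fock (Orb (Fin k))} (hψ : IsInSector n n ψ) (ρ nlo nhi alo ahi bhi shi : ℚ)
    (hnlo : (nlo : ℝ) ≤ (star ψ ⬝ᵥ ψ).re) (hnhi : (star ψ ⬝ᵥ ψ).re ≤ (nhi : ℝ))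
    (halo : (alo : ℝ) ≤ (star ψ ⬝ᵥ (F.hamiltonian *ᵥ ψ - ((ρ : ℝ) : ℂ) • ψ)).re)
    (hahi : (star ψ ⬝ᵥ (F.hamiltonian *ᵥ ψ - ((ρ : ℝ) : ℂ) • ψ)).re ≤ (ahi : ℝ))
    (hbhi : (star (F.hamiltonian *ᵥ ψ - ((ρ : ℝ) : ℂ) • ψ) ⬝ᵥ
      (F.hamiltonian *ᵥ ψ - ((ρ : ℝ) : ℂ) • ψ)).re ≤ (bhi : ℝ))
    (hshi : (star (spinPlus *ᵥ ψ) ⬝ᵥ (spinPlus *ᵥ ψ)).re ≤ (shi : ℝ))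
    (hcheckL : bhi - min ((L - ρ + (β - ρ)) * alo) ((L - ρ + (β - ρ)) * ahi)
        - min (-((L - ρ) * (β - ρ)) * nlo) (-((L - ρ) * (β - ρ)) * nhi)
        + shi / 8 * ((β - ρ) - (L - ρ)) ^ 2 < 0)
    (hchecklo : bhi - min ((lo - ρ + (β - ρ)) * alo) ((lo - ρ + (β - ρ)) * ahi)
        - min (-((lo - ρ) * (β - ρ)) * nlo) (-((lo - ρ) * (β - ρ)) * nhi)
        + shi / 8 * ((β - ρ) - (lo - ρ)) ^ 2 ≤ 0) :
    SingletLowerRow F n lo := by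
  have hH : F.hamiltonian.IsHermitian := Model.hamiltonian_isHermitian hF
  set N : ℝ := (star ψ ⬝ᵥ ψ).re with hNdef
  set A : ℝ := (star ψ ⬝ᵥ F.hamiltonian *ᵥ ψ).re with hAdef
  set M : ℝ := (star ψ ⬝ᵥ (F.hamiltonian * F.hamiltonian) *ᵥ ψ).re with hMdef
  set s : ℝ := (star (spinPlus *ᵥ ψ) ⬝ᵥ (spinPlus *ᵥ ψ)).re with hsdef
  set β' : ℝ := ((β : ℚ) : ℝ) with hβ'def
  set L' : ℝ := ((L : ℚ) : ℝ) with hL'def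
  set lo' : ℝ := ((lo : ℚ) : ℝ) with hlo'def
  have ha : (star ψ ⬝ᵥ (F.hamiltonian *ᵥ ψ - ((ρ : ℝ) : ℂ) • ψ)).re = A - (ρ : ℝ) * N :=
    TempleMoments.re_shifted_first_moment F.hamiltonian ψ _
  have hb : (star (F.hamiltonian *ᵥ ψ - ((ρ : ℝ) : ℂ) • ψ) ⬝ᵥ
      (F.hamiltonian *ᵥ ψ - ((ρ : ℝ) : ℂ) • ψ)).re = M - 2 * (ρ : ℝ) * A + (ρ : ℝ) ^ 2 * N :=
    re_residual_self_eq_moments hH ψ _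
  rw [ha] at halo hahi
  rw [hb] at hbhi
  -- the two corner checks bound the true shifted polynomial at `L − ρ` and at `lo − ρ`
  have hcL := templeSpinPoly_neg_of_check hnlo hnhi halo hahi hbhi hshi hcheckL
  have hclo := templeSpinPoly_nonpos_of_check hnlo hnhi halo hahi hbhi hshi hchecklo
  -- shift back to the unshifted polynomial of `singletLowerRow_of_temple_spin`
  have hPL : M - (L' + β') * A + L' * β' * N + s / 8 * (β' - L') ^ 2 < 0 := by
    rw [templeSpinPoly_shift ((ρ : ℚ) : ℝ) β' L']
    push_cast at hcL
    linarith
  have hPlo : M - (lo' + β') * A + lo' * β' * N + s / 8 * (β' - lo') ^ 2 ≤ 0 := by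
    rw [templeSpinPoly_shift ((ρ : ℚ) : ℝ) β' lo']
    push_cast at hclo
    linarith
  exact singletLowerRow_of_temple_spin_codimOne hF hG hL hψ le_rfl hPL hPlo

end Summit.Ventures.CertifiedQuantumChemistry

end
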